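import Mathlib
import HarnessLib
import HarnessLib.Audit
import Summits.AtomisticToContinuum.Statement
import Literature.MathematicalPhysics.QuantumManyBody.PeriodicBoseGas
import Literature.MathematicalPhysics.QuantumManyBody.PeriodicBoseGasFourier

/-!
Route: BECPercusPalm

CLOSED (retired) 2026-08-15T13:39:18Z by operator:999:1257524 — reason: not-a-thesis: assembly does not conclude the sub-problem Statement — note: D-0027 §2.1 audit (human 2026-08-15: routes that do not decide the summit are removed): the assembly concludes `Literature.MathematicalPhysics.QuantumManyBody.BoseGas.BoseEinsteinCondensation`, not the sub-problem statement; a NEW conforming route may be opened from the same idea (generated `closes . The file is kept as the record of this route; refuted decls are indexed as negative knowledge (`ledger negatives`).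

# Route BECPercusPalm — Palm density in L²(P) on the torus — Campbell–Mecke pins the linear Percus
term to the direct correlation function (finite in d=3), BEC = L²-summability of the nonlinear rest,
then BC transfer

X = NonlinearPalmBound ∧ GaussianPalmBound ∧ PalmChiSqCondensation ∧ BoundaryTransferWeak ("it
suffices to show X"); it realises
card percus-palm-direct-correlation (spine), with the criterion of card
chi2-deletion-tolerance-fermi-benchmark as rank 4 and the
boundary-condition transfer of route BECPeriodicReduction (item stmt-AtomisticToContinuum-0827,
verbatim) as rank 5. Setting: near-minimisers
Ψ of the PERIODIC N-body energy on the torus of side L = (N/ρ)^{1/3} (δ chosen after N, so every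
item is a statement about the torus ground
state Ψ₀ > 0). Objects (all typed as lower Lebesgue integrals over
Literature.MathematicalPhysics.QuantumManyBody.BoseGas.PeriodicTrialState):
the PALM χ² FUNCTIONAL F(Ψ) = L³ ∫_{cell^{N-1}} ∫_cell |Ψ(x,Y)|⁴ / μ_Ψ(Y) dx dY = E_P[(dQ_x/dP)²]
(Q_x = law of the other N−1 points given
one at x, P = their marginal law μ_Ψ); the STRUCTURE FACTOR S(k) = N⁻¹∫|Σ_j e^{ik·x_j}|²|Ψ|², k =
2πn/L; the GAUSSIAN (first-chaos) PART
G(Ψ) = Σ_{k≠0} (S(k)−1)²/((N−2)S(k)+1), which for the translation-invariant Ψ₀ is EXACTLY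
‖Y₁‖²_{L²(P)}, the squared norm of the projection
of Y = dQ_x/dP − 1 on the density modes (Campbell–Mecke fixes ⟨1+Y, ρ̂_k⟩ = e^{ik·x}(S(k)−1),
Bessel; Y₁ = Σ_j u_lin(x−x_j), û_lin = (S−1)/(ρS)
= minus the Ornstein–Zernike direct correlation function). The four parts: (rank 2)
NonlinearPalmBound: F ≤ 1 + G + C — the higher Percus
terms Σ_{n≥2}‖Y_n‖² are bounded uniformly in N at small ρ; (rank 3) GaussianPalmBound: G ≤ C —
finite in d = 3 because S(k) ≥ c·min(kξ,1)
makes ρ⁻¹∫(1−S)²/S d³k converge (= log L in d = 1: Pitaevskii–Stringari recovered at order one);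
(rank 4) PalmChiSqCondensation: per v,
F ≤ C on near-minimisers ⇒ constant-mode occupation ≥ N/C' (Hölder + Jensen for Ψ ≥ 0, phase
rigidity at fixed N) = the PeriodicBEC body;
(rank 5) BoundaryTransferWeak: PeriodicBEC(v) ⇒ HasGroundStateBEC v ρ (Dirichlet, mode-free).
Lean: `NonlinearPalmBound ∧ GaussianPalmBound ∧ PalmChiSqCondensation ∧ BoundaryTransferWeak` — the
four decls of this route file, bodies under ## Cruxes (rc 0 in Sketch.lean incl. a full proof of
Assembly); every constant exists (`lean search --decl`):
Literature.MathematicalPhysics.QuantumManyBody.BoseGas.{IsRepulsiveFiniteRange, PeriodicTrialState,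
periodicEnergy, periodicGroundStateEnergy, sideLength, cell, cellN, cellWave, latticeVec,
condensateOccupation, HasGroundStateBEC, BoseEinsteinCondensation}, Function.update, ENNReal.ofReal,
ENNReal.toReal, tsum, Filter.atTop.

## Assembly
Pure logic plus arithmetic in ℝ≥0∞ (done sorry-free in Sketch.lean, theorem assembly_holds, 25
lines): fix v, hv; ranks 2 and 3 give ρ₀ = min,
C = 1 + max(C₃,0) + max(C₂,0), the eventual N-sets intersect, δ = min(δ₂,δ₃), and F_i ≤ 1 + G + C₂ ≤
1 + C₃ + C₂ — this is the hypothesis of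
PalmChiSqCondensation for v (support item PalmChiSqBound is literally that hypothesis); rank 4 turns
it into the PeriodicBEC body for v; rank 5
(BoundaryTransferWeak, item 0827) turns that into ∃ρ₀ ∀ρ∈(0,ρ₀) HasGroundStateBEC v ρ, i.e. the
conjunct.

Rationale: WHY THIS LINE. Positivity routes to thermodynamic-limit BEC need one number: how singular the Palm
tilt dQ_x/dP of the ground-state point process |Ψ₀|² is;
its L²(P)-norm F bounds the condensate from below in one line (⟨φ₀,γφ₀⟩ ≥ N/F for Ψ ≥ 0: Hölder 1 =
∫p ≤ (∫√p)^{2/3}(∫p²)^{1/3}, then Jensen),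
a criterion outside the energy-window class of
Literature.Barriers.AtomisticToContinuum.KineticGapLengthScalesNarrow (it uses Ψ₀ > 0 and the
state, not the value E₀). The card's mechanism organises dQ_x/dP by ORTHOGONAL EXPANSION IN THE BATH
DENSITY FIELD — Percus's functional
test-particle expansion (Percus1962; Chandler1993's Gaussian field model is its n = 1 truncation)
made exact L²(P)-geometry by the refined
Campbell / Palm calculus of point processes (LastPenrose2017 Thm 9.1, Def 9.3): every chaos
coefficient is a connected correlation with one
leg at x, the linear one is the direct correlation function, and its norm ρ⁻¹∫(1−S)²/S is finite in
d = 3 by a structure-factor floor that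
T = 0 sum rules deliver (f-sum and Puff's cubic rule, Stringari1995 (7),(20)–(22), Puff1965; S ~ k ⇔
the screened 1/r² Jastrow tail of
ReattoChester1967 — automatic here, no resummation). Imported areas: point-process theory (Palm
distributions, Campbell–Mecke), classical
liquid-state theory (OZ/direct correlation, Percus–Widom insertion), sum-rule technology of quantum
fluids; the engine proposed for the one
genuinely open estimate (rank 2) is static nonlinear response = energies of weakly MODULATED dilute
gases (FournaisSolovej2020,
HaberbergerEtAl2023 technology), an allowed use of energies per
Literature.Barriers.AtomisticToContinuum.EnergyAsymptoticsWithoutCondensation.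
No prior route of this sub-problem uses positivity or point-process structure (BECInfraredBound:
infrared bounds; BECPeriodicReduction:
reformulation; BECPinning: pinned energies; BECRenormGroup: RG); the negatives index is empty.

RANKED CRUXES. #2 NonlinearPalmBound (crux) — (card item NL, typed) for every repulsive finite-range
radial v there is ρ₀ > 0 such that for 0 < ρ < ρ₀ there is C with: for all large N there is δ > 0
such that every periodic trial state Ψ on the torus of side L = (N/ρ)^{1/3} with periodicEnergy ≤
E₀^per + δ satisfies, for every slot i, F_i(Ψ) ≤ 1 + G(Ψ) + C, where F_i(Ψ) = L³ ∫_{cell^N} |Ψ(X)|⁴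
/ (∫_cell |Ψ(X with x_i ↦ y)|² dy) dX is the Palm χ² functional (= E_P[(dQ_x/dP)²], averaged over x)
and G(Ψ) = Σ_{n ∈ ℤ³∖0} (S_n − 1)²/((N−2)S_n + 1), S_n = N⁻¹∫|Σ_j e^{2πi n·x_j/L}|²|Ψ|², is the
Gaussian part; for the translation-invariant ground state F − 1 − G = Σ_{n≥2} ‖Y_n‖²_{L²(P)} exactly
(higher Percus/chaos terms of the Palm density), so the item says: the NONLINEAR static response of
the bath to the test particle is square-summable uniformly in N. [difficulty: open-problem] (why it
might fail: Beyond n=1 the inverse Gram matrices carry 1/S(k1)...1/S(kn) against connected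
(n+1)-point functions that must vanish in each soft leg (hyperuniform vertices, unproved even at
Bogoliubov level); L2-convergence of Percus's expansion is open classically; energy->response
transfer may lose k-factors.) [Percus1962, Chandler1993, LastPenrose2017, ReattoChester1967,
FournaisSolovej2020, HaberbergerEtAl2023,
Summits/AtomisticToContinuum/BoseEinsteinCondensation/Ideas/percus-palm-direct-correlation.md]
#3 GaussianPalmBound (crux) — (card item E2, typed) same quantifier prefix; conclusion G(Ψ) =
Σ_{n≠0} (S_n − 1)²/((N−2)S_n + 1) ≤ C. For Ψ₀ this is ‖Y₁‖²_{L²(P)} = Σ_{k≠0}(S(k)−1)²/((N−2)S(k)+1)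
→ ρ⁻¹∫(1−S)²/S d³k/(2π)³: finite in d = 3 given (IR) a floor S(k) ≥ c·min(kℓ,1) — even a k² floor
suffices in d = 3 — and (UV) Σ_k (S(k)−1)² ≤ CN, i.e. g − 1 ∈ L² uniformly in N; Bogoliubov value G
= (16πρa)^{3/2} J/(2π²ρ) = O(√(ρa³)) (computed, NOTES); in d = 1 the same object is ∫dk/S = log L
(no BEC), so the dimension enters exactly here. [difficulty: L] (why it might fail: Needs, uniformly
in N for the torus ground state, a floor S(k)>=c min(k l,1) (sum rules m1,m3 give it for v in C2
only; hard cores have m3=infinity) AND Sum_k (S(k)-1)^2 <= CN, i.e. g-1 in L2 uniformly (clustering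
of TL density correlations, not in print); Bragg peaks kill it.) [Stringari1995, Puff1965,
PitaevskiiStringari1991, ReattoChester1967, Feynman1954, LiebSeiringerSolovejYngvason2005]
#4 PalmChiSqCondensation (crux) — (criterion of card chi2-deletion-tolerance-fermi-benchmark, per
potential) for each repulsive finite-range v: IF (∃ρ₀ ∀ρ∈(0,ρ₀) ∃C ∀ᶠN ∃δ>0, every δ-near-minimiser
Ψ of the periodic problem at side (N/ρ)^{1/3} has F_i(Ψ) ≤ C for all i) THEN the PeriodicBEC body
holds for v (∃ρ₀ ∀ρ ∃c>0 ∀ᶠN ∃δ>0 ∀ near-minimisers, condensateOccupation ≥ cN; verbatim the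
hypothesis of BoundaryTransferWeak / body of stmt-AtomisticToContinuum-0826). Proof plan: for Ψ ≥ 0,
⟨φ₀,γ_Ψφ₀⟩ = N L⁻³ E_μ[(∫√p)²] ≥ N L⁻³ E_μ[1/∫p²] ≥ N/F (Hölder, Jensen); complex near-minimisers:
shrink δ below the fixed-N gap so Ψ ≈ e^{iθ}Ψ₀ and |Ψ| → Ψ₀ in L², use L² → trace-norm continuity of
Ψ ↦ γ_Ψ (constant c = 1/(2C)). [difficulty: M] (why it might fail: The one-line Hoelder+Jensen bound
n0 >= N/F holds for Psi >= 0 only; near-minimisers are complex, so it needs phase rigidity at fixed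
(N,L): unique positive torus ground state (Perron-Frobenius on a connected configuration space;
impenetrable-shell v disconnect it), gap, L2->trace continuity.) [PenroseOnsager1956,
LiebSeiringerSolovejYngvason2005, ReedSimonIV1978,
Summits/AtomisticToContinuum/BoseEinsteinCondensation/Ideas/chi2-deletion-tolerance-fermi-benchmark.md,
Literature.Barriers.AtomisticToContinuum.KineticGapLengthScalesNarrow]
#5 BoundaryTransferWeak (crux) — (shared verbatim with route BECPeriodicReduction, item
stmt-AtomisticToContinuum-0827) for each repulsive finite-range v, PeriodicBEC(v) implies ∃ρ₀>0
∀ρ∈(0,ρ₀) HasGroundStateBEC v ρ (Dirichlet ground state, λ_max(γ) ≥ cN via condensateNumber).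
Expected: Neumann bracketing of interior sub-boxes + a mode-free criterion (λ_max ≥ tr γ²/N); the
Palm functional F is itself BC-robust (Dirichlet one-body density non-uniformity costs 1 + O(ξ/L)),
so an inner-box variant of ranks 2–4 is the fallback. [deps: PalmChiSqCondensation] [difficulty: L]
(why it might fail: PeriodicBEC(v) is ground-state-only (delta after N) at the box (N/rho)^{1/3}:
the Dirichlet GS is a periodic trial state but lies a wall term >> delta above E0^per; interior
restrictions are neither periodic nor of sharp N, so the hypothesis may never fire. BEC is
BC-sensitive: Robinson1976.) [LiebSeiringerSolovejYngvason2005, Basti2022, BoccatoSeiringer2023,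
Junge2026, Robinson1976, LauwersVerbeureZagrebnov2003]
#9 StructureFactorFloor (support) — (card item SF) for every repulsive finite-range v, ρ small:
there are c, ℓ > 0 such that for all large N, some δ > 0, every δ-near-minimiser Ψ of the periodic
problem satisfies S_n(Ψ) ≥ c·min(ℓ|n|/L, 1) for all n ∈ ℤ³∖0 (S_n as above, |n|/L = |k|/2π). Engine
(v ∈ C², torus ground state; NOTES): m₁/N = k², m₃/N = 2k²[k⁴ + 4k²E_K/N + 2ρ∫(1−cos k·z)g ∂_z²v]
(Puff), m₂ ≤ √(m₁m₃) by Cauchy–Schwarz in ⟨·,(H−E₀)·⟩ (no spectral theorem), S = m₀ ≥ m₁²/m₂ ⇒ S(k)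
≥ ½·min(k/Λ,1), Λ² = 4E_K/N + 2ρ∫z²g|v''| = O(ρa); then transfer to near-minimisers by |S_Ψ − S_Φ| ≤
2N‖Ψ−Φ‖₂ with δ(N) small. Hard cores (m₃ = ∞) need m₂ ≤ CNk³ directly (first moment of
current–current correlations). Feeds GaussianPalmBound (IR half). [difficulty: M] [Stringari1995,
Puff1965, PitaevskiiStringari1991, Feynman1954, LiebSeiringerSolovejYngvason2005]
#9 PalmChiSqBound (support) — (the merged χ² statement, = hypothesis body of PalmChiSqCondensation
quantified over v; shared target with cards chi2-deletion-tolerance-fermi-benchmark and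
palm-density-integrability-ladder) for every repulsive finite-range v, ρ small, ∃C, for all large N
some δ > 0: every δ-near-minimiser of the periodic problem has F_i(Ψ) ≤ C for all i. It follows from
ranks 2 + 3 by arithmetic (this is proved inside Assembly in Sketch.lean); filed so that a DIRECT
proof of Palm-L² boundedness by any other engine (path-space second moments, cluster expansion of
the insertion weight) closes the route's spine too. [difficulty: open-problem] [LastPenrose2017,
Percus1962, Widom1963, PenroseOnsager1956]

TWO-LAYER PLAN. Foreseen glued splits (none filed now; k ≤ 3, depth 1): GaussianPalmBound ⇐
StructureFactorFloor → PairCorrelationL2 (Σ_{n≠0}(S_n−1)² ≤ CN,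
i.e. g−1 ∈ L² uniformly) → GaussianPalmBound (glue = summing (S−1)²/((N−2)S+1) ≤ (S−1)²·min(1,
2/((N−2)c·min(kℓ,1))) over the lattice: an
explicit lattice-sum estimate O(1/(ρcℓ³)) + UV). NonlinearPalmBound ⇐ SecondChaosBound (‖Y₂‖²:
connected 3-point function with one leg at x
against the degree-2 inverse Gram matrix = static QUADRATIC density response, IR-convergent) →
HigherChaosTail (Σ_{n≥3}, by local density /
cluster bounds at |k| ≳ 1/ξ and LDA energy expansions of multiply-modulated gases at |k| ≪ 1/ξ) →
NonlinearPalmBound. PalmChiSqCondensation ⇐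
PhaseRigidity (fixed-N uniqueness/positivity/gap on the torus: any two δ-near-minimisers are
e^{iθ}-close in L²) → PositiveCriterion (n₀ ≥ N/F for
Ψ ≥ 0, pure measure theory) → PalmChiSqCondensation. BoundaryTransferWeak: as planned in route
BECPeriodicReduction (Neumann bracketing + tr γ²).

KILL CRITERIA. Refutation of GaussianPalmBound (e.g. a proof that Σ_k(S(k)−1)²/N is unbounded in N,
or that S(k) vanishes faster than k² as k → 0 uniformly in N, for torus ground states at arbitrarily
small ρ) makes
F = ∞ for Ψ₀ and kills the whole Palm-L² family (this route, PalmChiSqBound, and the L² rung of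
palm-density-integrability-ladder): close
refuted:GaussianPalmBound and hand the witness to the entropy (KL) rung as a negative. Refutation of
NonlinearPalmBound with GaussianPalmBound
standing (higher chaos not summable) closes this route (refuted:NonlinearPalmBound) but not the
KL/entropic cards. Refutation of
PalmChiSqCondensation can only come from degenerate ground states for exotic admissible v
(impenetrable shells): pivot by restating ranks 2–4
for v finite a.e. plus hard cores and filing the shell case separately. ¬BoundaryTransferWeak kills
rank 5 for both routes: pivot to the
inner-box (Dirichlet) version of F, which is BC-robust. PeriodicBEC (0826) proved by any other route
moots ranks 2–4 (keep as structure results);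
BoseEinsteinCondensation proved elsewhere moots the route.

NOT DECOMPOSED YET. The chaos-by-chaos estimates behind rank 2 (‖Y₂‖², the tail), the two halves of
rank 3 (floor / L²-clustering), the phase-rigidity lemma of
rank 4, constants (c = ½, Λ² = 4E_K/N + 2ρ∫z²g|v''|, the Bogoliubov value of G), the hard-core
variants (m₃ = ∞: m₂ ≤ CNk³ via current
correlations or softening at scale ≪ a), and everything about the Dirichlet transfer beyond item
0827 — all layer-2 children or prover lemmas
(`--supports`), to be filed only after a crux closes (D-0019).

CHEAPEST FALSIFIER. (a) Two-page Bogoliubov computation of ‖Y₂‖² for the dilute gas: the connected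
three-point density function ⟨δρ_{−k−k'} δρ_k δρ_{k'}⟩ with one leg
Fourier-inverted to the test particle, contracted with the inverse Gram matrix of degree-2 density
polynomials (∝ 1/(S(k)S(k'))): if the k,k' → 0
integrals do not converge in d = 3, NonlinearPalmBound is dead at n = 2 and the route closes. (b)
Already run here (passes): the Gaussian part at
Bogoliubov level, S_B(k) = k/√(k²+16πρa): G = (16πρa)^{3/2}J/(2π²ρ) = O(√(ρa³)) < ∞, J =
∫₀^∞(√(t²+1)−t)² t/√(t²+1) dt. (c) Classical benchmark
(kit, cheap): hard spheres at packing 0.05–0.2, Widom insertion sampling of dQ_x/dP: measure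
(F−1−G)/G; Percus's expansion must converge in L²
there or rank 2 is hopeless. (d) d = 1 Tonks/CUE: check G ≍ log N carries the whole divergence
(F−1−G must not diverge faster).

NUMBERS. Bogoliubov (units ħ = 2m = 1): e(k) = √(k⁴+16πρak²), S_B(k) = k²/e(k) = k/√(k²+16πρa),
healing scale ξ = (16πρa)^{−1/2}; depletion
1 − n₀/N = (8/3√π)√(ρa³) (LiebSeiringerSolovejYngvason2005 App. A); LHY e₀ = 4πρa(1 +
(128/15√π)√(ρa³)) (FournaisSolovej2020, upper+lower);
G_Bog = O(√(ρa³)) = O((ρξ³)⁻¹); expected F − 1 = O(√(ρa³)), F − 1 − G = O(ρa³) (log-normal heuristic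
‖Y_n‖² ≈ σ^{2n}/n!). Sum-rule floor
(v ∈ C²): S(k) ≥ ½·min(k/Λ,1), Λ² = 4E_K/N + 2ρ∫z²g|v''| (Stringari1995 (7),(20)–(22));
Pitaevskii–Stringari ceiling S(k) ≤ k/(2mc)
(Stringari1995 (10)). Criterion constant: n₀ ≥ N/F (torus, Ψ ≥ 0); mode-free Dirichlet form tr γ² ≥
N²/F², λ_max ≥ N/F². Items at open: 7
(4 cruxes, 2 support, 1 assembly).

DEFINITION REQUESTS. None blocking (all items typed over existing declarations with `let`-bound
abbreviations). Convenience notions worth vendoring in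
Literature/MathematicalPhysics/QuantumManyBody (shared by cards
chi2-deletion-tolerance-fermi-benchmark, palm-density-integrability-ladder,
swap-affinity-insertion-variance, phonon-transport-fsum): `structureFactor N L n Ψ` (the let-bound S
above), `palmChiSq N L i Ψ` (F_i above),
`longitudinalCurrentSF` (N⁻¹‖Σ_j e^{ik·x_j} k̂·∇_jΨ‖², for the hard-core floor). To be filed as
definition items by the tenure planner if
provers ask; restating the items over them is a 1:1 `--restate`.

Novelty: Searches (2026-08-15): `lit search --hybrid "Palm distribution direct correlation function
Ornstein-Zernike test particle Percus insertion"`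
(12 docs, classical-liquid / soft-matter textbooks only); `lit search --source zbmath` ×3
("Ornstein-Zernike equation point process": 3 —
doi:10.1017/apr.2017.41 Last–Ziesche 2017, doi:10.1017/apr.2022.22 Jansen–Kolesnikov–Matzke 2023,
doi:10.1214/24-aihp1490 lace expansion RCM
— OZ/direct-CONNECTEDNESS via Palm calculus, never the density Palm tilt or quantum states; "Palm
measure ground state Bose gas …": 0;
"static structure factor lower bound Bose gas sum rules": 0); `lit search --source crossref "sum
rules Bose Einstein condensation structure
factor inequality"` (15: Stringari1995 = doi:10.1017/cbo9780511524240.007 and BEC volumes); OpenAlex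
/ S2 / arXiv HTTP 429 in this pass
(recorded); `lit frontier AtomisticToContinuum --since 2020` (30 rows: GP-scale/Neumann-localisation
BEC arXiv:2603.20776, arXiv:2510.20493,
energy expansions — no response-to-ODLRO or point-process programme); `lit bridges
AtomisticToContinuum --cross any` (Cenatiempo review
arXiv:1211.3772 only Bose item); `lit galaxy search --star all "Widom insertion condensate
fraction"` (0 hits in panama/pdf/crabby; three
further galaxy queries queued out > 90 s, saturated); `lit vsearch` (insertion / half-particle
formulation of γ: BEC textbooks griffin1995,
griffin1993 only); held texts read: griffin1995 pp. 73–81 (Stringari1995 (3)–(23)), last2017 pp.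
86–92 (Thm 9.1, D  [refs: 10.1017/apr.2017.41, 10.1017/apr.2022.22, 10.1214/24-aihp1490, 10.1017/cbo9780511524240.007, 10.1103/PhysRevLett.8.462, 10.1103/PhysRevE.48.2898, 10.1103/PhysRevB.14.2875, 10.1103/physrevb.30.152, 2603.20776, 2510.20493, 1211.3772, doi:10.1017/apr.2017.41, doi:10.1017/apr.2022.22, doi:10.1214/24-aihp1490, doi:10.1017/cbo9780511524240.007, doi:10.1103/PhysRevLett.8.462, doi:10.1103/PhysRevE.48.2898]

Barriers (technique_class: positivity, point-process, sum-rules, static-response): - technique_class: positivity, point-process, sum-rules, static-response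
- Literature.Barriers.AtomisticToContinuum.KineticGapLengthScales: evaded — no step "depletion ≤
gap⁻¹ × energy excess" anywhere; L-uniformity is the convergence of ρ⁻¹∫(1−S)²/S and of the higher
chaos sums at k → 0 (d = 3 lattice-sum estimates), and δ is chosen after N only to pin
near-minimisers to Ψ₀.
- Literature.Barriers.AtomisticToContinuum.KineticGapLengthScalesNarrow: evaded by construction —
every item is phase-blind or uses Ψ₀ > 0 (Palm disintegration, Hölder/Jensen), i.e. exits (a)
minimality beyond the value E₀ (double-commutator sum rules m₁, m₃) and (b) positivity with
genuinely 3-D input (∫k²dk/k < ∞), both on the entry's own list of open exits; the Galilei-boost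
witnesses have |Ψ_m| = |Φ| and are invisible to F, G, S, as they must be (they carry a full
condensate in another mode; rank 4's δ < gap excludes them).
- Literature.Barriers.AtomisticToContinuum.EnergyAsymptoticsWithoutCondensation: evaded — energies
are never compared to Bogoliubov values to infer BEC; they may enter rank 2 only as RESPONSES of
modulated gases transferred to γ through positivity; on the 1-D Lieb–Liniger witness the chain fails
at rank 3 (G = log L), consistent with the entry.
- Literature.Barriers.AtomisticToContinuum.BogoliubovPerturbationInfrared: applies in spirit to rank
2 (an expansion at T = 0 in d = 3); the expansion here is in STATIC, gauge-invariant density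
correlations organised in L²(P) (each soft leg

Novelty grade: new-combination — ROUTE REVIEW (refuter rreview 2026-08-15). STATE: not materialised (rev=0, no Theses file, no items) — reviewed on the payload's typed-informal bodies. FINDING (evidence BEC_PalmChiSq_counterexample.md on this workitem): NonlinearPalmBound (rank 2) and PalmChiSqBound (support) are FALSE for near-min (refuter refuter-rreview-route-AtomisticToContinu-35415862-0, 2026-08-15T13:47:11Z; prior: Percus1962 doi:10.1103/PhysRevLett.8.462, Chandler1993 doi:10.1103/PhysRevE.48.2898, LastPenrose2017 Thm 9.1/Def 9.3, Stringari1995 doi:10.1017/cbo9780511524240.007, card audit-12 (chi2-deletion-tolerance / percus-palm cards))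

History (route lifecycle, newest last):
- 2026-08-15T13:39:18Z · CLOSED retired — not-a-thesis: assembly does not conclude the sub-problem Statement (operator:999:1257524)

sub-problem: BoseEinsteinCondensation · status: closed(retired) · opened planner-plancard-AtomisticToContinuum-BoseEin-4213b4cc-0 2026-08-15T11:45:38Z · rev 0 · ledger route-AtomisticToContinuum-BECPercusPalm
GENERATED by the gate from the ledger (D-0016/17). Provers cite these decls: `theorem foo : Summit.AtomisticToContinuum.BoseEinsteinCondensation.Theses.BECPercusPalm.<Decl> := …` in Summits/AtomisticToContinuum/BoseEinsteinCondensation/Theorems/<Name>.lean.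
-/

namespace Summit.AtomisticToContinuum.BoseEinsteinCondensation.Theses.BECPercusPalm

open scoped BigOperators Topology Manifold Classical MeasureTheory ProbabilityTheory Matrix InnerProductSpace ComplexConjugate ContinuousMap
open Filter Set Function TopologicalSpace MeasureTheory

attribute [summit_statement] _root_.BoseEinsteinCondensation

/-- item stmt-AtomisticToContinuum-6293 · crux · rank 2 · closed · moot by None · by planner
why it might fail: Beyond n=1 the inverse Gram matrices carry 1/S(k1)...1/S(kn) against connected (n+1)-point functions that must vanish in each soft leg (hyperuniform vertices, unproved even at Bogoliubov level); L2-convergence of Percus's expansion is open classically; energy->response transfer may lose k-factors.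
sources: Percus1962, Chandler1993, LastPenrose2017, ReattoChester1967, FournaisSolovej2020, HaberbergerEtAl2023
[crux] (card item NL, typed) for every repulsive finite-range radial v there is ρ₀ > 0 such that for
0 < ρ < ρ₀ there is C with: for all large N there is δ > 0 such that every periodic trial state Ψ on
the torus of side L = (N/ρ)^{1/3} with periodicEnergy ≤ E₀^per + δ satisfies, for every slot i,
F_i(Ψ) ≤ 1 + G(Ψ) + C, where F_i(Ψ) = L³ ∫_{cell^N} |Ψ(X)|⁴ / (∫_cell |Ψ(X with x_i ↦ y)|² dy) dX is
the Palm χ² functional (= E_P[(dQ_x/dP)²], averaged over x) and G(Ψ) = Σ_{n ∈ ℤ³∖0} (S_n −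
1)²/((N−2)S_n + 1), S_n = N⁻¹∫|Σ_j e^{2πi n·x_j/L}|²|Ψ|², is the Gaussian part; for the
translation-invariant ground state F − 1 − G = Σ_{n≥2} ‖Y_n‖²_{L²(P)} exactly (higher Percus/chaos
terms of the Palm density), so the item says: the NONLINEAR static response of the bath to the test
particle is square-summable uniformly in N. [difficulty: open-problem] -/
@[route_item "route-AtomisticToContinuum-BECPercusPalm"]
def NonlinearPalmBound : Prop :=
  ∀ v : ℝ → ENNReal, Literature.MathematicalPhysics.QuantumManyBody.BoseGas.IsRepulsiveFiniteRange v → ∃ ρ₀ : ℝ, 0 < ρ₀ ∧ ∀ ρ : ℝ, 0 < ρ → ρ < ρ₀ → ∃ C : ℝ, ∀ᶠ N : ℕ in Filter.atTop, let L : ℝ := Literature.MathematicalPhysics.QuantumManyBody.BoseGas.sideLength ρ N; ∃ δ : ENNReal, 0 < δ ∧ ∀ Ψ : Literature.MathematicalPhysics.QuantumManyBody.BoseGas.PeriodicTrialState N L, Literature.MathematicalPhysics.QuantumManyBody.BoseGas.periodicEnergy v Ψ ≤ Literature.MathematicalPhysics.QuantumManyBody.BoseGas.periodicGroundStateEnergy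 v N L + δ → let S : (Fin 3 → ℤ) → ENNReal := fun n => (N : ENNReal)⁻¹ * (∫⁻ X in Literature.MathematicalPhysics.QuantumManyBody.BoseGas.cellN N L, (‖∑ j : Fin N, Literature.MathematicalPhysics.QuantumManyBody.BoseGas.cellWave L n (X j)‖₊ : ENNReal) ^ 2 * (‖Ψ.ψ X‖₊ : ENNReal) ^ 2); ∀ i : Fin N, ENNReal.ofReal (L ^ 3) * (∫⁻ X in Literature.MathematicalPhysics.QuantumManyBody.BoseGas.cellN N L, ((‖Ψ.ψ X‖₊ : ENNReal) ^ 4 / (∫⁻ y in Literature.MathematicalPhysics.QuantumManyBody.BoseGas.cell L, (‖Ψ.ψ (Function.update X i y)‖₊ : ENNReal) ^ 2))) ≤ 1 + (∑' n : Fin 3 → ℤ, if n = 0 then (0 : ENNReal) else ENNReal.ofReal (((S n).toReal - 1) ^ 2 / (((N - 2 : ℕ) : ℝ) * (S n).toReal + 1))) + ENNReal.ofReal C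

/-- item stmt-AtomisticToContinuum-6294 · crux · rank 3 · closed · moot by None · by planner
why it might fail: Needs, uniformly in N for the torus ground state, a floor S(k)>=c min(k l,1) (sum rules m1,m3 give it for v in C2 only; hard cores have m3=infinity) AND Sum_k (S(k)-1)^2 <= CN, i.e. g-1 in L2 uniformly (clustering of TL density correlations, not in print); Bragg peaks kill it.
sources: Stringari1995, Puff1965, PitaevskiiStringari1991, ReattoChester1967, Feynman1954, LiebSeiringerSolovejYngvason2005
[crux] (card item E2, typed) same quantifier prefix; conclusion G(Ψ) = Σ_{n≠0} (S_n − 1)²/((N−2)S_n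
+ 1) ≤ C. For Ψ₀ this is ‖Y₁‖²_{L²(P)} = Σ_{k≠0}(S(k)−1)²/((N−2)S(k)+1) → ρ⁻¹∫(1−S)²/S d³k/(2π)³:
finite in d = 3 given (IR) a floor S(k) ≥ c·min(kℓ,1) — even a k² floor suffices in d = 3 — and (UV)
Σ_k (S(k)−1)² ≤ CN, i.e. g − 1 ∈ L² uniformly in N; Bogoliubov value G = (16πρa)^{3/2} J/(2π²ρ) =
O(√(ρa³)) (computed, NOTES); in d = 1 the same object is ∫dk/S = log L (no BEC), so the dimension
enters exactly here. [difficulty: L] -/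
@[route_item "route-AtomisticToContinuum-BECPercusPalm"]
def GaussianPalmBound : Prop :=
  ∀ v : ℝ → ENNReal, Literature.MathematicalPhysics.QuantumManyBody.BoseGas.IsRepulsiveFiniteRange v → ∃ ρ₀ : ℝ, 0 < ρ₀ ∧ ∀ ρ : ℝ, 0 < ρ → ρ < ρ₀ → ∃ C : ℝ, ∀ᶠ N : ℕ in Filter.atTop, let L : ℝ := Literature.MathematicalPhysics.QuantumManyBody.BoseGas.sideLength ρ N; ∃ δ : ENNReal, 0 < δ ∧ ∀ Ψ : Literature.MathematicalPhysics.QuantumManyBody.BoseGas.PeriodicTrialState N L, Literature.MathematicalPhysics.QuantumManyBody.BoseGas.periodicEnergy v Ψ ≤ Literature.MathematicalPhysics.QuantumManyBody.BoseGas.periodicGroundStateEnergy v N L + δ → let S : (Fin 3 → ℤ) → ENNReal := fun n => (N : ENNReal)⁻¹ * (∫⁻ X in Literature.MathematicalPhysics.QuantumManyBody.BoseGas.cellN N L, (‖∑ j : Fin N, Literature.MathematicalPhysics.QuantumManyBody.BoseGas.cellWave L n (X j)‖₊ : ENNReal) ^ 2 * (‖Ψ.ψ X‖₊ : ENNReal)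 ^ 2); (∑' n : Fin 3 → ℤ, if n = 0 then (0 : ENNReal) else ENNReal.ofReal (((S n).toReal - 1) ^ 2 / (((N - 2 : ℕ) : ℝ) * (S n).toReal + 1))) ≤ ENNReal.ofReal C

/-- item stmt-AtomisticToContinuum-6295 · crux · rank 4 · closed · moot by None · by planner
why it might fail: The one-line Hoelder+Jensen bound n0 >= N/F holds for Psi >= 0 only; near-minimisers are complex, so it needs phase rigidity at fixed (N,L): unique positive torus ground state (Perron-Frobenius on a connected configuration space; impenetrable-shell v disconnect it), gap, L2->trace continuity.
sources: PenroseOnsager1956, LiebSeiringerSolovejYngvason2005, ReedSimonIV1978, Summits/AtomisticToContinuum/BoseEinsteinCondensation/Ideas/chi2-deletion-tolerance-fermi-benchmark.md, Literature.Barriers.AtomisticToContinuum.KineticGapLengthScalesNarrow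
[crux] (criterion of card chi2-deletion-tolerance-fermi-benchmark, per potential) for each repulsive
finite-range v: IF (∃ρ₀ ∀ρ∈(0,ρ₀) ∃C ∀ᶠN ∃δ>0, every δ-near-minimiser Ψ of the periodic problem at
side (N/ρ)^{1/3} has F_i(Ψ) ≤ C for all i) THEN the PeriodicBEC body holds for v (∃ρ₀ ∀ρ ∃c>0 ∀ᶠN
∃δ>0 ∀ near-minimisers, condensateOccupation ≥ cN; verbatim the hypothesis of BoundaryTransferWeak /
body of stmt-AtomisticToContinuum-0826). Proof plan: for Ψ ≥ 0, ⟨φ₀,γ_Ψφ₀⟩ = N L⁻³ E_μ[(∫√p)²] ≥ N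
L⁻³ E_μ[1/∫p²] ≥ N/F (Hölder, Jensen); complex near-minimisers: shrink δ below the fixed-N gap so Ψ
≈ e^{iθ}Ψ₀ and |Ψ| → Ψ₀ in L², use L² → trace-norm continuity of Ψ ↦ γ_Ψ (constant c = 1/(2C)).
[difficulty: M] -/
@[route_item "route-AtomisticToContinuum-BECPercusPalm"]
def PalmChiSqCondensation : Prop :=
  ∀ v : ℝ → ENNReal, Literature.MathematicalPhysics.QuantumManyBody.BoseGas.IsRepulsiveFiniteRange v → (∃ ρ₀ : ℝ, 0 < ρ₀ ∧ ∀ ρ : ℝ, 0 < ρ → ρ < ρ₀ → ∃ C : ℝ, ∀ᶠ N : ℕ in Filter.atTop, ∃ δ : ENNReal, 0 < δ ∧ ∀ Ψ : Literature.MathematicalPhysics.QuantumManyBody.BoseGas.PeriodicTrialState N (Literature.MathematicalPhysics.QuantumManyBody.BoseGas.sideLength ρ N), Literature.MathematicalPhysics.QuantumManyBody.BoseGas.periodicEnergy v Ψ ≤ Literature.MathematicalPhysics.QuantumManyBody.BoseGas.periodicGroundStateEnergy v N (Literature.MathematicalPhysics.QuantumManyBody.BoseGas.sideLength ρ N) +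 δ → ∀ i : Fin N, ENNReal.ofReal ((Literature.MathematicalPhysics.QuantumManyBody.BoseGas.sideLength ρ N) ^ 3) * (∫⁻ X in Literature.MathematicalPhysics.QuantumManyBody.BoseGas.cellN N (Literature.MathematicalPhysics.QuantumManyBody.BoseGas.sideLength ρ N), ((‖Ψ.ψ X‖₊ : ENNReal) ^ 4 / (∫⁻ y in Literature.MathematicalPhysics.QuantumManyBody.BoseGas.cell (Literature.MathematicalPhysics.QuantumManyBody.BoseGas.sideLength ρ N), (‖Ψ.ψ (Function.update X i y)‖₊ : ENNReal) ^ 2))) ≤ ENNReal.ofReal C) → ∃ ρ₀ : ℝ, 0 < ρ₀ ∧ ∀ ρ : ℝ, 0 < ρ → ρ < ρ₀ → ∃ c : ℝ, 0 < c ∧ ∀ᶠ N : ℕ in Filter.atTop, ∃ δ : ENNReal, 0 < δ ∧ ∀ Ψ : Literature.MathematicalPhysics.QuantumManyBody.BoseGas.PeriodicTrialState N (Literature.MathematicalPhysics.QuantumManyBody.BoseGas.sideLength ρ N), Literature.MathematicalPhysics.QuantumManyBody.BoseGas.periodicEnergy v Ψ ≤ Literature.MathematicalPhysics.QuantumManyBody.BoseGas.periodicGroundStateEnergy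 v N (Literature.MathematicalPhysics.QuantumManyBody.BoseGas.sideLength ρ N) + δ → ENNReal.ofReal (c * N) ≤ Literature.MathematicalPhysics.QuantumManyBody.BoseGas.condensateOccupation N (Literature.MathematicalPhysics.QuantumManyBody.BoseGas.sideLength ρ N) Ψ.ψ

/-- item stmt-AtomisticToContinuum-0827 · crux · rank 5 · open · by planner
why it might fail: PeriodicBEC(v) is ground-state-only (delta after N): the Dirichlet GS is a periodic trial state but lies a wall term >> delta above E0^per; interior restrictions are neither periodic nor of sharp N, so the hypothesis may never fire. BEC is BC-sensitive: Robinson1976.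
sources: LiebSeiringerSolovejYngvason2005, Basti2022, BoccatoSeiringer2023, Junge2026, Robinson1976, LauwersVerbeureZagrebnov2003
[crux] BoundaryTransferWeak (mode-free boundary-condition transfer, per potential): for each
repulsive finite-range v, PeriodicBEC(v) implies ∃ρ₀>0 ∀ρ∈(0,ρ₀) HasGroundStateBEC v ρ (Dirichlet
ground state, λ_max(γ) ≥ cN via condensateNumber). Not glue: near-minimiser slacks are O(N/L²) while
Dirichlet/periodic energies differ by a boundary term ≫ N/L², so no energy-comparison proof;
expected route: Neumann bracketing of interior sub-boxes (−Δ_Dir ≥ ⊕−Δ_Neu, v ≥ 0) + a mode-free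
criterion (λ_max ≥ tr γ²/N). Only the ENERGY analogue is in print (LiebSeiringerSolovejYngvason2005
Ch. 2 after (2.8)). v ≡ 0: hypothesis and conclusion both true. -/
@[route_item "route-AtomisticToContinuum-BECPercusPalm"]
def BoundaryTransferWeak : Prop :=
  ∀ v : ℝ → ENNReal, Literature.MathematicalPhysics.QuantumManyBody.BoseGas.IsRepulsiveFiniteRange v → (∃ ρ₀ : ℝ, 0 < ρ₀ ∧ ∀ ρ : ℝ, 0 < ρ → ρ < ρ₀ → ∃ c : ℝ, 0 < c ∧ ∀ᶠ N : ℕ in Filter.atTop, ∃ δ : ENNReal, 0 < δ ∧ ∀ Ψ : Literature.MathematicalPhysics.QuantumManyBody.BoseGas.PeriodicTrialState N (Literature.MathematicalPhysics.QuantumManyBody.BoseGas.sideLength ρ N), Literature.MathematicalPhysics.QuantumManyBody.BoseGas.periodicEnergy v Ψ ≤ Literature.MathematicalPhysics.QuantumManyBody.BoseGas.periodicGroundStateEnergy v N (Literature.MathematicalPhysics.QuantumManyBody.BoseGas.sideLength ρ N) + δ → ENNReal.ofReal (c * N) ≤ Literature.MathematicalPhysics.QuantumManyBody.BoseGas.condensateOccupation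 N (Literature.MathematicalPhysics.QuantumManyBody.BoseGas.sideLength ρ N) Ψ.ψ) → ∃ ρ₀ : ℝ, 0 < ρ₀ ∧ ∀ ρ : ℝ, 0 < ρ → ρ < ρ₀ → Literature.MathematicalPhysics.QuantumManyBody.BoseGas.HasGroundStateBEC v ρ

/-- item stmt-AtomisticToContinuum-6296 · support · rank 9 · closed · moot by None · by planner
sources: Stringari1995, Puff1965, PitaevskiiStringari1991, Feynman1954, LiebSeiringerSolovejYngvason2005
[support] (card item SF) for every repulsive finite-range v, ρ small: there are c, ℓ > 0 such that
for all large N, some δ > 0, every δ-near-minimiser Ψ of the periodic problem satisfies S_n(Ψ) ≥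
c·min(ℓ|n|/L, 1) for all n ∈ ℤ³∖0 (S_n as above, |n|/L = |k|/2π). Engine (v ∈ C², torus ground
state; NOTES): m₁/N = k², m₃/N = 2k²[k⁴ + 4k²E_K/N + 2ρ∫(1−cos k·z)g ∂_z²v] (Puff), m₂ ≤ √(m₁m₃) by
Cauchy–Schwarz in ⟨·,(H−E₀)·⟩ (no spectral theorem), S = m₀ ≥ m₁²/m₂ ⇒ S(k) ≥ ½·min(k/Λ,1), Λ² =
4E_K/N + 2ρ∫z²g|v''| = O(ρa); then transfer to near-minimisers by |S_Ψ − S_Φ| ≤ 2N‖Ψ−Φ‖₂ with δ(N)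
small. Hard cores (m₃ = ∞) need m₂ ≤ CNk³ directly (first moment of current–current correlations).
Feeds GaussianPalmBound (IR half). [difficulty: M] -/
@[route_item "route-AtomisticToContinuum-BECPercusPalm"]
def StructureFactorFloor : Prop :=
  ∀ v : ℝ → ENNReal, Literature.MathematicalPhysics.QuantumManyBody.BoseGas.IsRepulsiveFiniteRange v → ∃ ρ₀ : ℝ, 0 < ρ₀ ∧ ∀ ρ : ℝ, 0 < ρ → ρ < ρ₀ → ∃ c ℓ : ℝ, 0 < c ∧ 0 < ℓ ∧ ∀ᶠ N : ℕ in Filter.atTop, let L : ℝ := Literature.MathematicalPhysics.QuantumManyBody.BoseGas.sideLength ρ N; ∃ δ : ENNReal, 0 < δ ∧ ∀ Ψ : Literature.MathematicalPhysics.QuantumManyBody.BoseGas.PeriodicTrialState N L, Literature.MathematicalPhysics.QuantumManyBody.BoseGas.periodicEnergy v Ψ ≤ Literature.MathematicalPhysics.QuantumManyBody.BoseGas.periodicGroundStateEnergy v N L + δ → ∀ n : Fin 3 → ℤ, n ≠ 0 → ENNReal.ofReal (c * min (ℓ * ‖Literature.MathematicalPhysics.QuantumManyBody.BoseGas.latticeVec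 L⁻¹ n‖) 1) ≤ (N : ENNReal)⁻¹ * (∫⁻ X in Literature.MathematicalPhysics.QuantumManyBody.BoseGas.cellN N L, (‖∑ j : Fin N, Literature.MathematicalPhysics.QuantumManyBody.BoseGas.cellWave L n (X j)‖₊ : ENNReal) ^ 2 * (‖Ψ.ψ X‖₊ : ENNReal) ^ 2)

/-- item stmt-AtomisticToContinuum-6297 · support · rank 9 · closed · moot by None · by planner
sources: LastPenrose2017, Percus1962, Widom1963, PenroseOnsager1956
[support] (the merged χ² statement, = hypothesis body of PalmChiSqCondensation quantified over v;
shared target with cards chi2-deletion-tolerance-fermi-benchmark and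
palm-density-integrability-ladder) for every repulsive finite-range v, ρ small, ∃C, for all large N
some δ > 0: every δ-near-minimiser of the periodic problem has F_i(Ψ) ≤ C for all i. It follows from
ranks 2 + 3 by arithmetic (this is proved inside Assembly in Sketch.lean); filed so that a DIRECT
proof of Palm-L² boundedness by any other engine (path-space second moments, cluster expansion of
the insertion weight) closes the route's spine too. [difficulty: open-problem] -/
@[route_item "route-AtomisticToContinuum-BECPercusPalm"]
def PalmChiSqBound : Prop :=
  ∀ v : ℝ → ENNReal, Literature.MathematicalPhysics.QuantumManyBody.BoseGas.IsRepulsiveFiniteRange v → ∃ ρ₀ : ℝ, 0 < ρ₀ ∧ ∀ ρ : ℝ, 0 < ρ → ρ < ρ₀ → ∃ C : ℝ, ∀ᶠ N : ℕ in Filter.atTop, ∃ δ : ENNReal, 0 < δ ∧ ∀ Ψ : Literature.MathematicalPhysics.QuantumManyBody.BoseGas.PeriodicTrialState N (Literature.MathematicalPhysics.QuantumManyBody.BoseGas.sideLength ρ N), Literature.MathematicalPhysics.QuantumManyBody.BoseGas.periodicEnergy v Ψ ≤ Literature.MathematicalPhysics.QuantumManyBody.BoseGas.periodicGroundStateEnergy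 v N (Literature.MathematicalPhysics.QuantumManyBody.BoseGas.sideLength ρ N) + δ → ∀ i : Fin N, ENNReal.ofReal ((Literature.MathematicalPhysics.QuantumManyBody.BoseGas.sideLength ρ N) ^ 3) * (∫⁻ X in Literature.MathematicalPhysics.QuantumManyBody.BoseGas.cellN N (Literature.MathematicalPhysics.QuantumManyBody.BoseGas.sideLength ρ N), ((‖Ψ.ψ X‖₊ : ENNReal) ^ 4 / (∫⁻ y in Literature.MathematicalPhysics.QuantumManyBody.BoseGas.cell (Literature.MathematicalPhysics.QuantumManyBody.BoseGas.sideLength ρ N), (‖Ψ.ψ (Function.update X i y)‖₊ : ENNReal) ^ 2))) ≤ ENNReal.ofReal C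

/-- item stmt-AtomisticToContinuum-6298 · assembly · rank 1 · closed · moot by None · by planner
sources: LiebSeiringerSolovejYngvason2005, PenroseOnsager1956
[assembly] NonlinearPalmBound → GaussianPalmBound → PalmChiSqCondensation → BoundaryTransferWeak →
BoseEinsteinCondensation. -/
@[route_item "route-AtomisticToContinuum-BECPercusPalm"]
def Assembly : Prop :=
  NonlinearPalmBound → GaussianPalmBound → PalmChiSqCondensation → BoundaryTransferWeak → Literature.MathematicalPhysics.QuantumManyBody.BoseGas.BoseEinsteinCondensation

end Summit.AtomisticToContinuum.BoseEinsteinCondensation.Theses.BECPercusPalm
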